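import Literature.NumberTheory.EllipticCurves.Greenberg1999.TwoTorsionRamifiedIsogenyDualProofs
import Literature.NumberTheory.EllipticCurves.QuadraticTwist
import HarnessLib

/-!
# Greenberg's "ramified at `2`" / "odd" configuration of a rational point of order `2` under QUADRATIC
# TWIST: positive twists preserve it, negative twists exchange "odd" with "co-odd" (proofs only)

Topic `NumberTheory/EllipticCurves/Greenberg1999`; theorem-only companion (no definition, no named fact, no
instance, no `sorry`) of `TwoTorsionMuInvariant` (R. Greenberg, LNM 1716 (1999), §5, Props. 5.13 / 5.14 at
`p = 2`: `TwoTorsionRamifiedAtTwo x := v₂(x) < 0`, `TwoTorsionOdd W x :=` "`x` is the least real root of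
the `2`-division cubic") and of the siblings `TwoTorsion{Odd,Ramified}IsogenyDualProofs` (normal-form
currency `C • W`, dictionary «ramified ⟺ `v₂(a₂)` of a normal form is odd»).

**Setting.** `W/ℚ` with a rational point `P = (C.r, C.t)` of order `2` exhibited by a two-torsion normal form
`C • W : y² = x³ + ax² + bx`; the tree's quadratic twist `W.quadraticTwist d = ⟨0, d b₂/4, 0, d² b₄/2, d³ b₆/4⟩`
(`QuadraticTwist.lean`) carries the twisted point with abscissa `d·C.r`; any other model `A` of the twist
is linked by `C_A • A = W.quadraticTwist d`, and then the twisted point of `A` has abscissa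
`x_A = u_A²·(d·C.r) + r_A`.

**Theorems.**
* §1 `quadraticTwist_smul` — twisting commutes with changes of variables up to the explicit change
  `(u, d·r, 0, 0)`: `(C • W).quadraticTwist d = ⟨C.u, d·C.r, 0, 0⟩ • W.quadraticTwist d` (any field); a
  normal form twists to a normal form with `a₂ ↦ d a₂`, `a₄ ↦ d² a₄`.
* §2 (archimedean) on a normal form `y² = x(x² + ax + b)`: for `d > 0` the twisted point `(0,0)` of
  `y² = x(x² + dax + d²b)` is odd iff `T` is (`twoTorsionOdd_zero_quadraticTwist_iff_of_pos`); for `d < 0`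
  it is odd iff `T` is CO-ODD, i.e. every real root of `x² + ax + b` is `≤ 0` — `x(T)` is the LARGEST real
  `2`-torsion abscissa (`twoTorsionOdd_zero_quadraticTwist_iff_of_neg`); for general models
  `twoTorsionOdd_quadraticTwist_iff_of_pos/neg` (any `W`, any model `A` of the twist).
* §3 (`2`-adic) on globally minimal models with `a₁` odd on both sides (good ordinary or multiplicative at
  `2`; for the twist this means `d ≡ 1 (mod 4)` in practice) and `v₂(d) = 0`:
  **`twoTorsionRamifiedAtTwo_quadraticTwist_iff`** — the twisted point is ramified at `2` iff `P` is
  (`v₂(a₂)` of the normal form changes by `v₂(d) = 0`).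
* §4 consequences: for `d > 0` Greenberg's Prop-5.14 hypothesis, Prop-5.13 hypothesis and «neither» are
  each PRESERVED (`prop514Hypothesis_quadraticTwist_iff_of_pos`, …); for `d < 0` «ramified» is preserved
  and «odd» becomes «co-odd» (`configuration_quadraticTwist_of_neg`), so e.g. a (ramified, not odd) point
  whose abscissa is the largest real root twists to a (ramified AND odd) point: the MIXED / PURE split of
  the rational-`2`-torsion stratum is constant on the positive half of a quadratic-twist family but not on
  the negative half (unless the cubic has a single real root, where odd = co-odd = true).

Written for the BSD cell `bsd-2adic` (S3 head line over quadratic-twist families; pen ideas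
`gv-mixed-descent-two` / `shapiro-quadratic-descent-two` on 19556, whose habitats are cut by this
configuration).  Nothing about BSD, `μ` or `λ` is claimed.

## References
* [GreenbergLNM1716] R. Greenberg, *Iwasawa theory for elliptic curves*, LNM 1716 (1999), §5 pp. 120–124
  (Props. 5.13, 5.14, Remark; chunks p0168–p0176).
* [RubinSilverberg2002] K. Rubin, A. Silverberg, *Ranks of elliptic curves*, Bull. AMS 39 (2002), §1 (the
  quadratic twist). [SilvermanAEC2009] J. H. Silverman, *AEC*, III.1, X.2, X.5 Cor. 5.4.
-/

set_option autoImplicit false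

open WeierstrassCurve

namespace Literature.NumberTheory.EllipticCurves.Greenberg1999

/-! ### §1. Twisting commutes with changes of variables; normal forms twist to normal forms -/

section Smul

variable {K : Type*} [Field K] (W : WeierstrassCurve K) (C : VariableChange K) (d : K)

/-- **`(C • W)^d = (u, d·r, 0, 0) • W^d`**: the tree's quadratic twist (built from `b₂, b₄, b₆`) commutes
with a change of variables `(u, r, s, t)` up to the change `(u, d·r, 0, 0)` (`s, t` disappear because the
twist has `a₁ = a₃ = 0`; `b₂ ↦ u⁻²(b₂ + 12r)`, `b₄ ↦ u⁻⁴(b₄ + rb₂ + 6r²)`, `b₆ ↦ u⁻⁶(b₆ + 2rb₄ + r²b₂ + 4r³)`).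
[cite: RubinSilverberg2002, §1] [cite: SilvermanAEC2009, III.1 Table 3.1] -/
theorem quadraticTwist_smul (h2 : (2 : K) ≠ 0) :
    (C • W).quadraticTwist d = (⟨C.u, d * C.r, 0, 0⟩ : VariableChange K) • W.quadraticTwist d := by
  have h4 : (4 : K) ≠ 0 := by
    rw [show (4 : K) = 2 * 2 by norm_num]; exact mul_ne_zero h2 h2
  have hb₂ := variableChange_b₂ W C
  have hb₄ := variableChange_b₄ W C
  have hb₆ := variableChange_b₆ W C
  ext
  · simp [quadraticTwist, variableChange_a₁]
  · simp only [quadraticTwist, variableChange_a₂, hb₂]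
    field_simp
    ring
  · simp [quadraticTwist, variableChange_a₃]
  · simp only [quadraticTwist, variableChange_a₄, hb₂, hb₄]
    field_simp
    ring
  · simp only [quadraticTwist, variableChange_a₆, hb₂, hb₄, hb₆]
    field_simp
    ring

/-- A two-torsion normal form twists to a two-torsion normal form (`a₆(V^d) = d³ b₆/4 = 0`).
[cite: RubinSilverberg2002, §1] -/
theorem isTwoTorsionNF_quadraticTwist (V : WeierstrassCurve K) [hV : V.IsTwoTorsionNF] :
    (V.quadraticTwist d).IsTwoTorsionNF := by
  refine ⟨rfl, rfl, ?_⟩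
  show d ^ 3 * V.b₆ / 4 = 0
  rw [show V.b₆ = V.a₃ ^ 2 + 4 * V.a₆ from rfl, hV.a₃, hV.a₆]
  ring

/-- `a₂(V^d) = d·a₂(V)` for a normal form (`b₂ = 4a₂`). [cite: RubinSilverberg2002, §1] -/
theorem quadraticTwist_a₂_of_isTwoTorsionNF (V : WeierstrassCurve K) [hV : V.IsTwoTorsionNF] (h4 : (4 : K) ≠ 0) :
    (V.quadraticTwist d).a₂ = d * V.a₂ := by
  show d * V.b₂ / 4 = d * V.a₂
  rw [show V.b₂ = V.a₁ ^ 2 + 4 * V.a₂ from rfl, hV.a₁]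
  field_simp
  ring

/-- `a₄(V^d) = d²·a₄(V)` for a normal form (`b₄ = 2a₄`). [cite: RubinSilverberg2002, §1] -/
theorem quadraticTwist_a₄_of_isTwoTorsionNF (V : WeierstrassCurve K) [hV : V.IsTwoTorsionNF] (h2 : (2 : K) ≠ 0) :
    (V.quadraticTwist d).a₄ = d ^ 2 * V.a₄ := by
  show d ^ 2 * V.b₄ / 2 = d ^ 2 * V.a₄
  rw [show V.b₄ = 2 * V.a₄ + V.a₁ * V.a₃ from rfl, hV.a₁]
  field_simp
  ring

end Smul

/-! ### §2. The archimedean condition under twist: odd ↦ odd (`d > 0`), odd ↦ co-odd (`d < 0`) -/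

section OddTwist

variable (V : WeierstrassCurve ℚ) [V.IsTwoTorsionNF] (d : ℚ)

/-- The `2`-division data of the twisted normal form: `T^d = (0,0)` is odd iff every real root of
`x² + d a x + d² b` is `≥ 0`. [cite: GreenbergLNM1716, §5 Remark (chunk p0174)] -/
theorem twoTorsionOdd_zero_quadraticTwist_iff :
    TwoTorsionOdd (V.quadraticTwist d) 0 ↔
      ∀ ρ : ℝ, ρ ^ 2 + ((d : ℝ) * V.a₂) * ρ + ((d : ℝ) ^ 2 * V.a₄) = 0 → 0 ≤ ρ := by
  haveI := isTwoTorsionNF_quadraticTwist d V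
  rw [twoTorsionOdd_zero_iff_of_isTwoTorsionNF, quadraticTwist_a₂_of_isTwoTorsionNF d V four_ne_zero,
    quadraticTwist_a₄_of_isTwoTorsionNF d V two_ne_zero]
  push_cast
  exact Iff.rfl

/-- **Positive twist preserves «odd»** on a normal form: the real roots of `x² + dax + d²b` are `d` times
those of `x² + ax + b`. [cite: GreenbergLNM1716, §5 Remark (chunk p0174)] -/
theorem twoTorsionOdd_zero_quadraticTwist_iff_of_pos (hd : 0 < d) :
    TwoTorsionOdd (V.quadraticTwist d) 0 ↔ TwoTorsionOdd V 0 := by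
  rw [twoTorsionOdd_zero_quadraticTwist_iff, twoTorsionOdd_zero_iff_of_isTwoTorsionNF]
  have hdR : (0 : ℝ) < (d : ℝ) := by exact_mod_cast hd
  constructor
  · intro h σ hσ
    have := h ((d : ℝ) * σ) (by linear_combination (d : ℝ) ^ 2 * hσ)
    nlinarith
  · intro h ρ hρ
    have := h (ρ / (d : ℝ)) (by
      field_simp
      linear_combination hρ)
    exact (div_nonneg_iff.mp this).elim (fun h' ↦ h'.1) fun h' ↦ absurd h'.2 (not_le.mpr hdR)

/-- **Negative twist turns «odd» into «co-odd»** on a normal form: for `d < 0`, `T^d` is odd iff every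
real root of `x² + ax + b` is `≤ 0` (`x(T) = 0` is the LARGEST real `2`-torsion abscissa of `V`).
[cite: GreenbergLNM1716, §5 Remark (chunk p0174)] -/
theorem twoTorsionOdd_zero_quadraticTwist_iff_of_neg (hd : d < 0) :
    TwoTorsionOdd (V.quadraticTwist d) 0 ↔ ∀ ρ : ℝ, ρ ^ 2 + (V.a₂ : ℝ) * ρ + (V.a₄ : ℝ) = 0 → ρ ≤ 0 := by
  rw [twoTorsionOdd_zero_quadraticTwist_iff]
  have hdR : (d : ℝ) < 0 := by exact_mod_cast hd
  constructor
  · intro h σ hσ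
    have := h ((d : ℝ) * σ) (by linear_combination (d : ℝ) ^ 2 * hσ)
    nlinarith
  · intro h ρ hρ
    have hd0 : (d : ℝ) ≠ 0 := hdR.ne
    have := h (ρ / (d : ℝ)) (by
      field_simp
      linear_combination hρ)
    exact (div_nonpos_iff.mp this).elim (fun h' ↦ h'.1) fun h' ↦ absurd h'.2 (not_le.mpr hdR)

/-- «Co-odd» at `T = (0,0)` on a normal form in terms of the `2`-division cubic: every real root of
`4x³ + b₂x² + 2b₄x + b₆ = 4x(x² + ax + b)` is `≤ 0`. [cite: GreenbergLNM1716, §5 Remark (chunk p0174)] -/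
theorem forall_root_le_zero_iff_of_isTwoTorsionNF :
    (∀ r : ℝ, 4 * r ^ 3 + (V.b₂ : ℝ) * r ^ 2 + 2 * (V.b₄ : ℝ) * r + (V.b₆ : ℝ) = 0 → r ≤ 0) ↔
      ∀ ρ : ℝ, ρ ^ 2 + (V.a₂ : ℝ) * ρ + (V.a₄ : ℝ) = 0 → ρ ≤ 0 := by
  have hb₂ : V.b₂ = 4 * V.a₂ := by
    rw [show V.b₂ = V.a₁ ^ 2 + 4 * V.a₂ from rfl, a₁_of_isTwoTorsionNF]; ring
  have hb₄ : V.b₄ = 2 * V.a₄ := by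
    rw [show V.b₄ = 2 * V.a₄ + V.a₁ * V.a₃ from rfl, a₁_of_isTwoTorsionNF]; ring
  have hb₆ : V.b₆ = 0 := by
    rw [show V.b₆ = V.a₃ ^ 2 + 4 * V.a₆ from rfl, a₃_of_isTwoTorsionNF, a₆_of_isTwoTorsionNF]; ring
  rw [hb₂, hb₄, hb₆]
  push_cast
  constructor
  · intro h ρ hρ
    by_cases hρ0 : ρ = 0
    · exact hρ0 ▸ le_rfl
    · exact h ρ (by linear_combination 4 * ρ * hρ)
  · intro h ρ hρ
    by_cases hρ0 : ρ = 0
    · exact hρ0 ▸ le_rfl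
    · refine h ρ ?_
      have h4 : (4 * ρ) * (ρ ^ 2 + (V.a₂ : ℝ) * ρ + (V.a₄ : ℝ)) = 0 := by linear_combination hρ
      exact (mul_eq_zero.mp h4).resolve_left (mul_ne_zero four_ne_zero hρ0)

end OddTwist

/-- «Co-odd» is invariant under rational changes of variables (same proof as `twoTorsionOdd_smul_iff`:
`x = u²ρ + r`, `u² > 0`). [cite: GreenbergLNM1716, §5 Remark (chunk p0174)] [cite: SilvermanAEC2009, III.1 Table 3.1] -/
theorem forall_root_le_smul_iff (W : WeierstrassCurve ℚ) (C : VariableChange ℚ) (ρ : ℚ) :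
    (∀ r : ℝ, 4 * r ^ 3 + ((C • W).b₂ : ℝ) * r ^ 2 + 2 * ((C • W).b₄ : ℝ) * r + ((C • W).b₆ : ℝ) = 0 →
        r ≤ (ρ : ℝ)) ↔
      ∀ r : ℝ, 4 * r ^ 3 + (W.b₂ : ℝ) * r ^ 2 + 2 * (W.b₄ : ℝ) * r + (W.b₆ : ℝ) = 0 →
        r ≤ (((C.u : ℚ) ^ 2 * ρ + C.r : ℚ) : ℝ) := by
  have hU : ((C.u⁻¹ : ℚˣ) : ℚ) = (C.u : ℚ)⁻¹ := Units.val_inv_eq_inv_val C.u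
  have hu0 : ((C.u : ℚ) : ℝ) ≠ 0 := by exact_mod_cast Units.ne_zero _
  have hb₂ : (C • W).b₂ = (C.u : ℚ)⁻¹ ^ 2 * (W.b₂ + 12 * C.r) := by rw [variableChange_b₂, hU]
  have hb₄ : (C • W).b₄ = (C.u : ℚ)⁻¹ ^ 4 * (W.b₄ + C.r * W.b₂ + 6 * C.r ^ 2) := by
    rw [variableChange_b₄, hU]
  have hb₆ : (C • W).b₆ = (C.u : ℚ)⁻¹ ^ 6 * (W.b₆ + 2 * C.r * W.b₄ + C.r ^ 2 * W.b₂ + 4 * C.r ^ 3) := by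
    rw [variableChange_b₆, hU]
  have key : ∀ σ : ℝ, 4 * σ ^ 3 + ((C • W).b₂ : ℝ) * σ ^ 2 + 2 * ((C • W).b₄ : ℝ) * σ + ((C • W).b₆ : ℝ)
      = (((C.u : ℚ) : ℝ) ^ 6)⁻¹ * (4 * (((C.u : ℚ) : ℝ) ^ 2 * σ + C.r) ^ 3
        + (W.b₂ : ℝ) * (((C.u : ℚ) : ℝ) ^ 2 * σ + C.r) ^ 2
        + 2 * (W.b₄ : ℝ) * (((C.u : ℚ) : ℝ) ^ 2 * σ + C.r) + (W.b₆ : ℝ)) := by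
    intro σ
    rw [hb₂, hb₄, hb₆]
    push_cast
    field_simp
    ring
  have hu6 : (((C.u : ℚ) : ℝ) ^ 6)⁻¹ ≠ 0 := inv_ne_zero (pow_ne_zero _ hu0)
  have hu2 : (0 : ℝ) < ((C.u : ℚ) : ℝ) ^ 2 := by positivity
  constructor
  · intro h x hx
    have hσ := h ((x - C.r) / ((C.u : ℚ) : ℝ) ^ 2) (by
      rw [key]
      have : ((C.u : ℚ) : ℝ) ^ 2 * ((x - C.r) / ((C.u : ℚ) : ℝ) ^ 2) + C.r = x := by
        field_simp
        ring
      rw [this, hx, mul_zero])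
    have := (div_le_iff₀ hu2).mp hσ
    push_cast
    linarith
  · intro h σ hσ
    have hx := h (((C.u : ℚ) : ℝ) ^ 2 * σ + C.r) (by
      have h0 := key σ
      rw [hσ] at h0
      rcases mul_eq_zero.mp h0.symm with h1 | h1
      · exact absurd h1 hu6
      · exact_mod_cast h1)
    push_cast at hx
    nlinarith [hx, hu2, mul_le_mul_of_nonneg_left (le_refl σ) hu2.le]

/-! ### §3. «Odd» and «ramified» under twist, for arbitrary models -/

section Models

variable (W A : WeierstrassCurve ℚ) (C C_A : VariableChange ℚ) (d : ℚ)

/-- The change of variables that puts a model `A` of the twist (`C_A • A = W^d`) in the twisted normal form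
`(C • W)^d`: `C'' = (u, d·r, 0, 0) * C_A`, so that `C'' • A = (C • W)^d`; its `r`-component
`u_A²·(d·C.r) + r_A` is the abscissa on `A` of the twisted point. [cite: RubinSilverberg2002, §1] [cite: SilvermanAEC2009, III.1 Table 3.1] -/
theorem twistChange_smul_eq (hA : C_A • A = W.quadraticTwist d) :
    ((⟨C.u, d * C.r, 0, 0⟩ : VariableChange ℚ) * C_A) • A = (C • W).quadraticTwist d := by
  rw [mul_smul, hA, quadraticTwist_smul W C d two_ne_zero]

/-- The `r`-component of that change: `x_A = u_A²·(d·C.r) + r_A`. [cite: SilvermanAEC2009, III.1 Table 3.1] -/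
theorem twistChange_r :
    ((⟨C.u, d * C.r, 0, 0⟩ : VariableChange ℚ) * C_A).r = (C_A.u : ℚ) ^ 2 * (d * C.r) + C_A.r := by
  rw [VariableChange.mul_def]
  ring

/-- The twisted point is a rational point of order `2` of `A`: `HasRationalTwoTorsionX A (u_A²(d·C.r) + r_A)`.
[cite: GreenbergLNM1716, Prop. 5.14 (chunk p0170)] -/
theorem hasRationalTwoTorsionX_twist [(C • W).IsTwoTorsionNF] (hA : C_A • A = W.quadraticTwist d) :
    HasRationalTwoTorsionX A ((C_A.u : ℚ) ^ 2 * (d * C.r) + C_A.r) := by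
  haveI : (((⟨C.u, d * C.r, 0, 0⟩ : VariableChange ℚ) * C_A) • A).IsTwoTorsionNF := by
    rw [twistChange_smul_eq W A C C_A d hA]; exact isTwoTorsionNF_quadraticTwist d (C • W)
  rw [← twistChange_r C C_A d]
  exact hasRationalTwoTorsionX_of_isTwoTorsionNF_smul A _

/-- **Positive twist preserves «odd»** (any model `W` of `E` with `P = (C.r, C.t)`, any model `A` of the
twist, `C_A • A = W^d`, `d > 0`). [cite: GreenbergLNM1716, §5 Remark (chunk p0174)] -/
theorem twoTorsionOdd_quadraticTwist_iff_of_pos [W.IsElliptic] [(C • W).IsTwoTorsionNF]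
    (hA : C_A • A = W.quadraticTwist d) (hd : 0 < d) :
    TwoTorsionOdd A ((C_A.u : ℚ) ^ 2 * (d * C.r) + C_A.r) ↔ TwoTorsionOdd W C.r := by
  have h1 : TwoTorsionOdd A ((C_A.u : ℚ) ^ 2 * (d * C.r) + C_A.r) ↔
      TwoTorsionOdd ((C • W).quadraticTwist d) 0 := by
    rw [← twistChange_smul_eq W A C C_A d hA, twoTorsionOdd_smul_iff, twistChange_r]; simp
  have h2 : TwoTorsionOdd W C.r ↔ TwoTorsionOdd (C • W) 0 := by
    rw [twoTorsionOdd_smul_iff]; simp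
  rw [h1, h2, twoTorsionOdd_zero_quadraticTwist_iff_of_pos (C • W) d hd]

/-- **Negative twist turns «odd» into «co-odd»** (`d < 0`): the twisted point is odd iff `x(P) = C.r` is
the LARGEST real `2`-torsion abscissa of `W`. [cite: GreenbergLNM1716, §5 Remark (chunk p0174)] -/
theorem twoTorsionOdd_quadraticTwist_iff_of_neg [W.IsElliptic] [(C • W).IsTwoTorsionNF]
    (hA : C_A • A = W.quadraticTwist d) (hd : d < 0) :
    TwoTorsionOdd A ((C_A.u : ℚ) ^ 2 * (d * C.r) + C_A.r) ↔
      ∀ r : ℝ, 4 * r ^ 3 + (W.b₂ : ℝ) * r ^ 2 + 2 * (W.b₄ : ℝ) * r + (W.b₆ : ℝ) = 0 → r ≤ (C.r : ℝ) := by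
  have h1 : TwoTorsionOdd A ((C_A.u : ℚ) ^ 2 * (d * C.r) + C_A.r) ↔
      TwoTorsionOdd ((C • W).quadraticTwist d) 0 := by
    rw [← twistChange_smul_eq W A C C_A d hA, twoTorsionOdd_smul_iff, twistChange_r]; simp
  rw [h1, twoTorsionOdd_zero_quadraticTwist_iff_of_neg (C • W) d hd,
    ← forall_root_le_zero_iff_of_isTwoTorsionNF (C • W)]
  have h3 := forall_root_le_smul_iff W C 0
  simp only [Rat.cast_zero, mul_zero, zero_add] at h3
  exact h3

/-- **«Ramified at `2`» is preserved by odd twists** (both models globally minimal with `a₁` odd — good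
ordinary or multiplicative at `2` —, `v₂(d) = 0`): the normal form's `a₂` becomes `d·a₂`, same parity
of `v₂`. [cite: GreenbergLNM1716, §5 definition of "ramified at 2" (chunk p0168)] -/
theorem twoTorsionRamifiedAtTwo_quadraticTwist_iff [W.IsElliptic] [W.IsGloballyMinimal] [A.IsElliptic]
    [A.IsGloballyMinimal] (ha₁W : Odd (integralModelInt W).a₁) (ha₁A : Odd (integralModelInt A).a₁)
    [(C • W).IsTwoTorsionNF] (hA : C_A • A = W.quadraticTwist d) (hd : padicValRat 2 d = 0) (hd0 : d ≠ 0) :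
    TwoTorsionRamifiedAtTwo ((C_A.u : ℚ) ^ 2 * (d * C.r) + C_A.r) ↔ TwoTorsionRamifiedAtTwo C.r := by
  haveI : Fact (Nat.Prime 2) := ⟨Nat.prime_two⟩
  set C'' : VariableChange ℚ := (⟨C.u, d * C.r, 0, 0⟩ : VariableChange ℚ) * C_A with hC''
  haveI hNF'' : (C'' • A).IsTwoTorsionNF := by
    rw [hC'', twistChange_smul_eq W A C C_A d hA]; exact isTwoTorsionNF_quadraticTwist d (C • W)
  obtain ⟨hne, h1⟩ := twoTorsionRamifiedAtTwo_iff_odd_padicValRat_a₂ W ha₁W C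
  obtain ⟨-, h2⟩ := twoTorsionRamifiedAtTwo_iff_odd_padicValRat_a₂ A ha₁A C''
  rw [← twistChange_r C C_A d, h1, h2, hC'', twistChange_smul_eq W A C C_A d hA,
    quadraticTwist_a₂_of_isTwoTorsionNF d (C • W) four_ne_zero, padicValRat.mul hd0 hne, hd, zero_add]

end Models

/-! ### §4. Greenberg's configurations under twist -/

section Configurations

variable (W A : WeierstrassCurve ℚ) [W.IsElliptic] [W.IsGloballyMinimal] [A.IsElliptic] [A.IsGloballyMinimal]
  (C C_A : VariableChange ℚ) (d : ℚ)

/-- **Positive odd twists preserve the whole configuration**: «ramified» and «odd» are each unchanged, so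
Greenberg's Prop-5.14 hypothesis, Prop-5.13 hypothesis and «neither» hold at the twisted point iff at `P`.
[cite: GreenbergLNM1716, Props. 5.13–5.14 (chunks p0168–p0170)] -/
theorem configuration_quadraticTwist_of_pos (ha₁W : Odd (integralModelInt W).a₁)
    (ha₁A : Odd (integralModelInt A).a₁) [(C • W).IsTwoTorsionNF] (hA : C_A • A = W.quadraticTwist d)
    (hd : 0 < d) (hd2 : padicValRat 2 d = 0) :
    (TwoTorsionRamifiedAtTwo ((C_A.u : ℚ) ^ 2 * (d * C.r) + C_A.r) ↔ TwoTorsionRamifiedAtTwo C.r) ∧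
      (TwoTorsionOdd A ((C_A.u : ℚ) ^ 2 * (d * C.r) + C_A.r) ↔ TwoTorsionOdd W C.r) :=
  ⟨twoTorsionRamifiedAtTwo_quadraticTwist_iff W A C C_A d ha₁W ha₁A hA hd2 hd.ne',
    twoTorsionOdd_quadraticTwist_iff_of_pos W A C C_A d hA hd⟩

/-- **Prop. 5.14's hypothesis is invariant under positive odd twists.** [cite: GreenbergLNM1716, Prop. 5.14 (chunk p0170)] -/
theorem prop514Hypothesis_quadraticTwist_iff_of_pos (ha₁W : Odd (integralModelInt W).a₁)
    (ha₁A : Odd (integralModelInt A).a₁) [(C • W).IsTwoTorsionNF] (hA : C_A • A = W.quadraticTwist d)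
    (hd : 0 < d) (hd2 : padicValRat 2 d = 0) :
    ((TwoTorsionRamifiedAtTwo ((C_A.u : ℚ) ^ 2 * (d * C.r) + C_A.r) ∧
        ¬ TwoTorsionOdd A ((C_A.u : ℚ) ^ 2 * (d * C.r) + C_A.r)) ∨
      (TwoTorsionOdd A ((C_A.u : ℚ) ^ 2 * (d * C.r) + C_A.r) ∧
        ¬ TwoTorsionRamifiedAtTwo ((C_A.u : ℚ) ^ 2 * (d * C.r) + C_A.r))) ↔
    ((TwoTorsionRamifiedAtTwo C.r ∧ ¬ TwoTorsionOdd W C.r) ∨ (TwoTorsionOdd W C.r ∧ ¬ TwoTorsionRamifiedAtTwo C.r)) := by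
  obtain ⟨hR, hO⟩ := configuration_quadraticTwist_of_pos W A C C_A d ha₁W ha₁A hA hd hd2
  rw [hR, hO]

/-- **Prop. 5.13's hypothesis («ramified AND odd») is invariant under positive odd twists.**
[cite: GreenbergLNM1716, Prop. 5.13 (chunk p0168)] -/
theorem ramified_and_odd_quadraticTwist_iff_of_pos (ha₁W : Odd (integralModelInt W).a₁)
    (ha₁A : Odd (integralModelInt A).a₁) [(C • W).IsTwoTorsionNF] (hA : C_A • A = W.quadraticTwist d)
    (hd : 0 < d) (hd2 : padicValRat 2 d = 0) :
    (TwoTorsionRamifiedAtTwo ((C_A.u : ℚ) ^ 2 * (d * C.r) + C_A.r) ∧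
        TwoTorsionOdd A ((C_A.u : ℚ) ^ 2 * (d * C.r) + C_A.r)) ↔
      (TwoTorsionRamifiedAtTwo C.r ∧ TwoTorsionOdd W C.r) := by
  obtain ⟨hR, hO⟩ := configuration_quadraticTwist_of_pos W A C C_A d ha₁W ha₁A hA hd hd2
  rw [hR, hO]

/-- **Negative odd twists: «ramified» is kept, «odd» becomes «co-odd»** (`x(P)` the largest real
`2`-torsion abscissa). [cite: GreenbergLNM1716, Props. 5.13–5.14 (chunks p0168–p0170)] -/
theorem configuration_quadraticTwist_of_neg (ha₁W : Odd (integralModelInt W).a₁)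
    (ha₁A : Odd (integralModelInt A).a₁) [(C • W).IsTwoTorsionNF] (hA : C_A • A = W.quadraticTwist d)
    (hd : d < 0) (hd2 : padicValRat 2 d = 0) :
    (TwoTorsionRamifiedAtTwo ((C_A.u : ℚ) ^ 2 * (d * C.r) + C_A.r) ↔ TwoTorsionRamifiedAtTwo C.r) ∧
      (TwoTorsionOdd A ((C_A.u : ℚ) ^ 2 * (d * C.r) + C_A.r) ↔
        ∀ r : ℝ, 4 * r ^ 3 + (W.b₂ : ℝ) * r ^ 2 + 2 * (W.b₄ : ℝ) * r + (W.b₆ : ℝ) = 0 → r ≤ (C.r : ℝ)) :=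
  ⟨twoTorsionRamifiedAtTwo_quadraticTwist_iff W A C C_A d ha₁W ha₁A hA hd2 hd.ne,
    twoTorsionOdd_quadraticTwist_iff_of_neg W A C C_A d hA hd⟩

/-- **Single real `2`-torsion point (e.g. `Δ < 0`): the configuration is invariant under EVERY odd twist**,
since «odd» and «co-odd» both hold when `x(P)` is the only real root of the `2`-division cubic.
[cite: GreenbergLNM1716, §5 Remark (chunk p0170) (negative discriminant: ⟨P⟩ is automatically odd)] -/
theorem configuration_quadraticTwist_of_unique_real_root (ha₁W : Odd (integralModelInt W).a₁)
    (ha₁A : Odd (integralModelInt A).a₁) [(C • W).IsTwoTorsionNF] (hA : C_A • A = W.quadraticTwist d)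
    (hd0 : d ≠ 0) (hd2 : padicValRat 2 d = 0)
    (huniq : ∀ r : ℝ, 4 * r ^ 3 + (W.b₂ : ℝ) * r ^ 2 + 2 * (W.b₄ : ℝ) * r + (W.b₆ : ℝ) = 0 → r = (C.r : ℝ)) :
    (TwoTorsionRamifiedAtTwo ((C_A.u : ℚ) ^ 2 * (d * C.r) + C_A.r) ↔ TwoTorsionRamifiedAtTwo C.r) ∧
      TwoTorsionOdd A ((C_A.u : ℚ) ^ 2 * (d * C.r) + C_A.r) ∧ TwoTorsionOdd W C.r := by
  refine ⟨twoTorsionRamifiedAtTwo_quadraticTwist_iff W A C C_A d ha₁W ha₁A hA hd2 hd0, ?_,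
    fun r hr ↦ (huniq r hr).symm.le⟩
  rcases lt_or_gt_of_ne hd0 with hd | hd
  · exact (twoTorsionOdd_quadraticTwist_iff_of_neg W A C C_A d hA hd).mpr fun r hr ↦ (huniq r hr).le
  · exact (twoTorsionOdd_quadraticTwist_iff_of_pos W A C C_A d hA hd).mpr fun r hr ↦ (huniq r hr).symm.le

end Configurations

end Literature.NumberTheory.EllipticCurves.Greenberg1999
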